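import Summits.QuantumFields.YangMills.Theorems.UnitScaleTiltProp7RowHOfLocalModelRowsPt
import Summits.QuantumFields.YangMills.Theorems.UnitScaleTiltProp7CurrentConjugationDefect
import HarnessLib

/-!
# Route `UnitScaleTilt`, crux K1 «MinimiserStabilityRegPr» (stmt-QuantumFields-19200), route-R E′ growth side, R5 row (H) — «(H)-RED-2′»: THE LAPLACIAN ROW hRes OF
# ✓ `Prop7RowHOfLocalModelRowsPt.rowH_of_localModelRows_pt` FROM THE CENTRE-BASED ALIGNMENT ROW hKg′-K(fam), THE DIRICHLET ROW hDir, AND THE DISPLAYED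
# «LAP-OF-COMB-TRANSPORT» DECOMPOSITION hLap — door-first bookkeeping (★p1 g16 NAMER WORD 11 (1), 2026-08-29 00:04Z)

Cell `ym3-torus`, width seat `ym-ust-19200-w4` (gen 7), line HKGK-ANALYTIC.  THEOREMS ONLY (0 `def`, 0 `sorry`); `--supports stmt-QuantumFields-19200`, count-neutral.
YM₃ on T³ is a ladder rung (R3), not the Clay problem; nothing here claims hRes, (H), S3, E′, a stub, the crux, d = 4 or the mass gap — hLap and hKg′-K(fam) are DISPLAYED.

WHY (this seat's (H)-RED-2 LOCATE + ADDENDUM, bus 2026-08-29 00:0xZ; ★p1 g16 WORDS 9 (1), 11 (1)).  For the h-averaged offset-comb transported local models `Ψ^h_y` the Laplacian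
`Δ_WΨ^h_y(z) = Σ_μD^*_μD_μΨ^h_y(z)` splits (continuum reading in the comb-axial gauge of one ordering: `∂·A = −∫_{leg 3}(D^*F) − ∫_{leg 2}(D^*F) + ∫_{leg 2}∂_{σ₃}F_{σ₃σ₂}`) into
CURRENT conjugation differences along the legs — booked by ✓ `Prop7CurrentConjugationDefect.sum_norm_sq_conjDefect_le` applied to `φ := Ψ^h_y` ITSELF into the curvature-commutator
energy `Σ_p‖[hol_p, Ψ^h_y(x_p)]‖²` = the CENTRE-BASED (Kg′) family (no re-base to `φ₀(x)`, hence none of the point-pinned path sums located by px9 g4) plus `a²`× the covariant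
Dirichlet energy of `Ψ^h_y` (= hDir's object) —, h-TELESCOPED endpoint plaquette terms (the `h`-average turns the non-current `∂_{σ₃}F` into a difference quotient `≤ 2a∕ℓ′`; again
(Kg′)), and second-order double commutators (`≤ R·a·‖D_WΨ‖`, again `a²`× hDir's object).  The LATTICE IDENTITY behind this («LAP-OF-COMB-TRANSPORT», routeR-w1's ladder calculus)
is NOT in the tree; this file DISPLAYS its summed consequence as the row hLap and proves the bookkeeping hRes ⟸ hLap ∧ hKg′-K(fam) ∧ hDir with explicit `ζ_R, θ_R`.

WHAT IS PROVED (ns `…Theorems.Prop7RowHResOfHKgK`).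
* ★★★ `rowHRes_of_hLap_hKgPrime_hDir` — in ✓p679008's letters (the SAME supported sums `Σ_yΣ_{z∈N(y)}` for the Laplacian group `LAP` and the Dirichlet group `DIR` of the local
  models `Ψ`): IF `LAP ≤ A₁·KGP + A₂·a²·DIR` (hLap; `KGP` = the (Kg′)-family energy of `Ψ`, any real), `KGP ≤ C_g′·K + θ_g′·e·ℓ⁻²·M` (hKg′-K(fam)), `c_D·DIR ≤ ζ_D·K + θ_D·e·ℓ⁻²·M`
  (hDir VERBATIM, `c_D = 2·(3·(2d·(6∕ℓ)))·(3∕ℓ)`), with `0 ≤ A₁, A₂`, `a² ≤ c_D` (at the carrier `a = e·ℓ⁻²`, so `a² = e²ℓ⁻⁴ ≤ 648ℓ⁻²` — a window the assembler has for free),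
  THEN hRes VERBATIM: `6·LAP ≤ ζ_R·K + θ_R·e·ℓ⁻²·M` with **`ζ_R := 6·(A₁·C_g′ + A₂·ζ_D)`, `θ_R := 6·(A₁·θ_g′ + A₂·θ_D)`**.
HONEST SCOPE.  Real bookkeeping over displayed rows; hLap's inhabitant (the identity + ✓p679821) and hKg′-K(fam)'s (the ℛ-line: `Σ_p‖[hol_p, Ψ(x_p)]‖² = K_W(D_WΨ)` is ℛ-ROW★'s
left side for the section `s := Ψ^h_y`) are separate files; nothing of hRes∕(H)∕S3 is claimed beyond this implication.

References: T. Bałaban, CMP 99 (1985) 389–434 [Balaban1985BackgroundPropagators] ((3.3)–(3.4) pp.390–391, (3.8)–(3.9) p.392, Thm 3.11 p.416); CMP 102 (1985) 277–309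
[Balaban1985Variational] (Prop. 7 p.299, (141)–(143)); CMP 95 (1984) 17–40 [Balaban1984PropagatorsI] ((1.18) p.20, Prop. 1.1 (1.90) p.33).
-/

set_option autoImplicit false

noncomputable section

open scoped BigOperators Matrix.Norms.L2Operator Matrix

namespace Summit.QuantumFields.YangMills.Theorems.Prop7RowHResOfHKgK

open Literature.MathematicalPhysics.QuantumFieldTheory.Balaban1983to89
open Literature.MathematicalPhysics.QuantumFieldTheory.Balaban1983to89.T3ContinuumYM3Torus
open B9Eq39Adjoint (R covD covDstar divB)
open B9TorusCalculus (torusT)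
open B10Eq27TorusAxialLog (unitsField toUField)
open B5Eq118OneStroke (iterBlockOf)
open B15DeterminingSets (embIter)

/-- ★★★ **hRes ⟸ hLap ∧ hKg′-K(fam) ∧ hDir** (door-first; ✓p679008's letters).  Run `K`, height `n`, `SU(2)` background `W`, local models `Ψ : Site (F.P K) (K−n) → Site (F.P K) 0 → M₂(ℂ)`,
reals `Kr Mr e a A₁ A₂ KGP C_g′ θ_g′ ζ_D θ_D`.  With `LAP := Σ_yΣ_{z∈N(y)}‖Δ_WΨ_y(z)‖²` and `DIR := Σ_yΣ_{z∈N(y)}Σ_μ(‖D^*_μΨ_y(z)‖² + ‖D_μΨ_y(z)‖²)` (the supported sums of hRes∕hDir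
VERBATIM) and `c_D` hDir's coefficient: IF `LAP ≤ A₁·KGP + A₂·a²·DIR` (hLap), `KGP ≤ C_g′·Kr + θ_g′·e·ℓ⁻²·Mr` (hKg′-K(fam)), `c_D·DIR ≤ ζ_D·Kr + θ_D·e·ℓ⁻²·Mr` (hDir), `0 ≤ A₁`,
`0 ≤ A₂`, `a² ≤ c_D`, THEN `6·LAP ≤ 6(A₁C_g′ + A₂ζ_D)·Kr + 6(A₁θ_g′ + A₂θ_D)·e·ℓ⁻²·Mr` = hRes with `ζ_R = 6(A₁C_g′ + A₂ζ_D)`, `θ_R = 6(A₁θ_g′ + A₂θ_D)`.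
[cite: Balaban1985BackgroundPropagators, (3.3)-(3.4) pp.390-391, (3.8)-(3.9) p.392; Balaban1985Variational, Prop. 7 p.299, (141)-(143)] -/
theorem rowHRes_of_hLap_hKgPrime_hDir (F : T3Family) (K n : ℕ)
    (W : GaugeField (F.P K) 0 (Matrix.specialUnitaryGroup (Fin 2) ℂ))
    (Ψ : Site (F.P K) (K - n) → Site (F.P K) 0 → Matrix (Fin 2) (Fin 2) ℂ)
    {Kr Mr e a A₁ A₂ KGP Cg' θg' ζ_D θ_D : ℝ}
    (hA₁ : 0 ≤ A₁) (hA₂ : 0 ≤ A₂)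
    (ha : a ^ 2 ≤ 2 * (3 * (2 * ((F.P K).d : ℝ) * (6 / ((((F.P K).L ^ (K - n) : ℕ) : ℝ)))) * (3 / ((((F.P K).L ^ (K - n) : ℕ) : ℝ)))))
    (hLap : (∑ y : Site (F.P K) (K - n), ∑ z : Site (F.P K) 0,
            (if (∀ ν : Fin (F.P K).d,
                (y ν = (iterBlockOf (K - n) (fun κ => z κ - (((((F.P K).L ^ (K - n) - 1) / 2 : ℕ)) : ZMod ((F.P K).sitesPerDir 0)))) ν - 1
                ∨ y ν = (iterBlockOf (K - n) (fun κ => z κ - (((((F.P K).L ^ (K - n) - 1) / 2 : ℕ)) : ZMod ((F.P K).sitesPerDir 0)))) ν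
                ∨ y ν = (iterBlockOf (K - n) (fun κ => z κ - (((((F.P K).L ^ (K - n) - 1) / 2 : ℕ)) : ZMod ((F.P K).sitesPerDir 0)))) ν + 1
                ∨ y ν = (iterBlockOf (K - n) (fun κ => z κ - (((((F.P K).L ^ (K - n) - 1) / 2 : ℕ)) : ZMod ((F.P K).sitesPerDir 0)))) ν + 2))
              then ‖divB (torusT (F.P K) 0) (fun κ z => unitsField (toUField W) ⟨z, κ⟩)
                (fun μ => covD (torusT (F.P K) 0) (fun κ z => unitsField (toUField W) ⟨z, κ⟩) μ (Ψ y)) z‖ ^ 2 else 0)) ≤ A₁ * KGP + A₂ * a ^ 2 * (∑ y : Site (F.P K) (K - n), ∑ z : Site (F.P K) 0,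
              (if (∀ ν : Fin (F.P K).d,
                  (y ν = (iterBlockOf (K - n) (fun κ => z κ - (((((F.P K).L ^ (K - n) - 1) / 2 : ℕ)) : ZMod ((F.P K).sitesPerDir 0)))) ν - 1
                  ∨ y ν = (iterBlockOf (K - n) (fun κ => z κ - (((((F.P K).L ^ (K - n) - 1) / 2 : ℕ)) : ZMod ((F.P K).sitesPerDir 0)))) ν
                  ∨ y ν = (iterBlockOf (K - n) (fun κ => z κ - (((((F.P K).L ^ (K - n) - 1) / 2 : ℕ)) : ZMod ((F.P K).sitesPerDir 0)))) ν + 1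
                  ∨ y ν = (iterBlockOf (K - n) (fun κ => z κ - (((((F.P K).L ^ (K - n) - 1) / 2 : ℕ)) : ZMod ((F.P K).sitesPerDir 0)))) ν + 2))
                then ∑ μ : Fin (F.P K).d,
                  (‖covDstar (torusT (F.P K) 0) (fun κ z => unitsField (toUField W) ⟨z, κ⟩) μ (Ψ y) z‖ ^ 2
                    + ‖covD (torusT (F.P K) 0) (fun κ z => unitsField (toUField W) ⟨z, κ⟩) μ (Ψ y) z‖ ^ 2) else 0)))
    (hKgP : KGP ≤ Cg' * Kr + θg' * e * (((F.L : ℝ) ^ (K - n)) ^ 2)⁻¹ * Mr)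
    (hDir : 2 * (3 * (2 * ((F.P K).d : ℝ) * (6 / ((((F.P K).L ^ (K - n) : ℕ) : ℝ)))) * (3 / ((((F.P K).L ^ (K - n) : ℕ) : ℝ)))) * (∑ y : Site (F.P K) (K - n), ∑ z : Site (F.P K) 0,
              (if (∀ ν : Fin (F.P K).d,
                  (y ν = (iterBlockOf (K - n) (fun κ => z κ - (((((F.P K).L ^ (K - n) - 1) / 2 : ℕ)) : ZMod ((F.P K).sitesPerDir 0)))) ν - 1
                  ∨ y ν = (iterBlockOf (K - n) (fun κ => z κ - (((((F.P K).L ^ (K - n) - 1) / 2 : ℕ)) : ZMod ((F.P K).sitesPerDir 0)))) ν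
                  ∨ y ν = (iterBlockOf (K - n) (fun κ => z κ - (((((F.P K).L ^ (K - n) - 1) / 2 : ℕ)) : ZMod ((F.P K).sitesPerDir 0)))) ν + 1
                  ∨ y ν = (iterBlockOf (K - n) (fun κ => z κ - (((((F.P K).L ^ (K - n) - 1) / 2 : ℕ)) : ZMod ((F.P K).sitesPerDir 0)))) ν + 2))
                then ∑ μ : Fin (F.P K).d,
                  (‖covDstar (torusT (F.P K) 0) (fun κ z => unitsField (toUField W) ⟨z, κ⟩) μ (Ψ y) z‖ ^ 2
                    + ‖covD (torusT (F.P K) 0) (fun κ z => unitsField (toUField W) ⟨z, κ⟩) μ (Ψ y) z‖ ^ 2) else 0)) ≤ ζ_D * Kr + θ_D * e * (((F.L : ℝ) ^ (K - n)) ^ 2)⁻¹ * Mr) :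
    6 * (∑ y : Site (F.P K) (K - n), ∑ z : Site (F.P K) 0,
            (if (∀ ν : Fin (F.P K).d,
                (y ν = (iterBlockOf (K - n) (fun κ => z κ - (((((F.P K).L ^ (K - n) - 1) / 2 : ℕ)) : ZMod ((F.P K).sitesPerDir 0)))) ν - 1
                ∨ y ν = (iterBlockOf (K - n) (fun κ => z κ - (((((F.P K).L ^ (K - n) - 1) / 2 : ℕ)) : ZMod ((F.P K).sitesPerDir 0)))) ν
                ∨ y ν = (iterBlockOf (K - n) (fun κ => z κ - (((((F.P K).L ^ (K - n) - 1) / 2 : ℕ)) : ZMod ((F.P K).sitesPerDir 0)))) ν + 1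
                ∨ y ν = (iterBlockOf (K - n) (fun κ => z κ - (((((F.P K).L ^ (K - n) - 1) / 2 : ℕ)) : ZMod ((F.P K).sitesPerDir 0)))) ν + 2))
              then ‖divB (torusT (F.P K) 0) (fun κ z => unitsField (toUField W) ⟨z, κ⟩)
                (fun μ => covD (torusT (F.P K) 0) (fun κ z => unitsField (toUField W) ⟨z, κ⟩) μ (Ψ y)) z‖ ^ 2 else 0)) ≤ (6 * (A₁ * Cg' + A₂ * ζ_D)) * Kr + (6 * (A₁ * θg' + A₂ * θ_D)) * e * (((F.L : ℝ) ^ (K - n)) ^ 2)⁻¹ * Mr := by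
  set LAP : ℝ := (∑ y : Site (F.P K) (K - n), ∑ z : Site (F.P K) 0,
            (if (∀ ν : Fin (F.P K).d,
                (y ν = (iterBlockOf (K - n) (fun κ => z κ - (((((F.P K).L ^ (K - n) - 1) / 2 : ℕ)) : ZMod ((F.P K).sitesPerDir 0)))) ν - 1
                ∨ y ν = (iterBlockOf (K - n) (fun κ => z κ - (((((F.P K).L ^ (K - n) - 1) / 2 : ℕ)) : ZMod ((F.P K).sitesPerDir 0)))) ν
                ∨ y ν = (iterBlockOf (K - n) (fun κ => z κ - (((((F.P K).L ^ (K - n) - 1) / 2 : ℕ)) : ZMod ((F.P K).sitesPerDir 0)))) ν + 1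
                ∨ y ν = (iterBlockOf (K - n) (fun κ => z κ - (((((F.P K).L ^ (K - n) - 1) / 2 : ℕ)) : ZMod ((F.P K).sitesPerDir 0)))) ν + 2))
              then ‖divB (torusT (F.P K) 0) (fun κ z => unitsField (toUField W) ⟨z, κ⟩)
                (fun μ => covD (torusT (F.P K) 0) (fun κ z => unitsField (toUField W) ⟨z, κ⟩) μ (Ψ y)) z‖ ^ 2 else 0)) with hLAPdef
  set DIR : ℝ := (∑ y : Site (F.P K) (K - n), ∑ z : Site (F.P K) 0,
              (if (∀ ν : Fin (F.P K).d,
                  (y ν = (iterBlockOf (K - n) (fun κ => z κ - (((((F.P K).L ^ (K - n) - 1) / 2 : ℕ)) : ZMod ((F.P K).sitesPerDir 0)))) ν - 1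
                  ∨ y ν = (iterBlockOf (K - n) (fun κ => z κ - (((((F.P K).L ^ (K - n) - 1) / 2 : ℕ)) : ZMod ((F.P K).sitesPerDir 0)))) ν
                  ∨ y ν = (iterBlockOf (K - n) (fun κ => z κ - (((((F.P K).L ^ (K - n) - 1) / 2 : ℕ)) : ZMod ((F.P K).sitesPerDir 0)))) ν + 1
                  ∨ y ν = (iterBlockOf (K - n) (fun κ => z κ - (((((F.P K).L ^ (K - n) - 1) / 2 : ℕ)) : ZMod ((F.P K).sitesPerDir 0)))) ν + 2))
                then ∑ μ : Fin (F.P K).d,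
                  (‖covDstar (torusT (F.P K) 0) (fun κ z => unitsField (toUField W) ⟨z, κ⟩) μ (Ψ y) z‖ ^ 2
                    + ‖covD (torusT (F.P K) 0) (fun κ z => unitsField (toUField W) ⟨z, κ⟩) μ (Ψ y) z‖ ^ 2) else 0)) with hDIRdef
  set cD : ℝ := 2 * (3 * (2 * ((F.P K).d : ℝ) * (6 / ((((F.P K).L ^ (K - n) : ℕ) : ℝ)))) * (3 / ((((F.P K).L ^ (K - n) : ℕ) : ℝ)))) with hcDdef
  -- `DIR ≥ 0` (a sum of `if … then (squares) else 0`)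
  have hDIR0 : 0 ≤ DIR := by
    rw [hDIRdef]
    refine Finset.sum_nonneg fun y _ => Finset.sum_nonneg fun z _ => ?_
    split_ifs
    · exact Finset.sum_nonneg fun μ _ => add_nonneg (sq_nonneg _) (sq_nonneg _)
    · exact le_rfl
  -- `a²·DIR ≤ c_D·DIR ≤ ζ_D·Kr + θ_D·e·ℓ⁻²·Mr`
  have h1 : a ^ 2 * DIR ≤ ζ_D * Kr + θ_D * e * (((F.L : ℝ) ^ (K - n)) ^ 2)⁻¹ * Mr :=
    (mul_le_mul_of_nonneg_right ha hDIR0).trans hDir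
  have h2 : A₂ * a ^ 2 * DIR ≤ A₂ * (ζ_D * Kr + θ_D * e * (((F.L : ℝ) ^ (K - n)) ^ 2)⁻¹ * Mr) := by
    rw [mul_assoc]; exact mul_le_mul_of_nonneg_left h1 hA₂
  have h3 : A₁ * KGP ≤ A₁ * (Cg' * Kr + θg' * e * (((F.L : ℝ) ^ (K - n)) ^ 2)⁻¹ * Mr) := mul_le_mul_of_nonneg_left hKgP hA₁
  have h4 : LAP ≤ A₁ * (Cg' * Kr + θg' * e * (((F.L : ℝ) ^ (K - n)) ^ 2)⁻¹ * Mr) + A₂ * (ζ_D * Kr + θ_D * e * (((F.L : ℝ) ^ (K - n)) ^ 2)⁻¹ * Mr) := hLap.trans (add_le_add h3 h2)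
  have h5 : 6 * LAP ≤ 6 * (A₁ * (Cg' * Kr + θg' * e * (((F.L : ℝ) ^ (K - n)) ^ 2)⁻¹ * Mr) + A₂ * (ζ_D * Kr + θ_D * e * (((F.L : ℝ) ^ (K - n)) ^ 2)⁻¹ * Mr)) :=
    mul_le_mul_of_nonneg_left h4 (by norm_num)
  calc 6 * LAP ≤ 6 * (A₁ * (Cg' * Kr + θg' * e * (((F.L : ℝ) ^ (K - n)) ^ 2)⁻¹ * Mr) + A₂ * (ζ_D * Kr + θ_D * e * (((F.L : ℝ) ^ (K - n)) ^ 2)⁻¹ * Mr)) := h5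
    _ = (6 * (A₁ * Cg' + A₂ * ζ_D)) * Kr + (6 * (A₁ * θg' + A₂ * θ_D)) * e * (((F.L : ℝ) ^ (K - n)) ^ 2)⁻¹ * Mr := by ring

end Summit.QuantumFields.YangMills.Theorems.Prop7RowHResOfHKgK

end
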